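import Mathlib

/-!
# The phantom form at a reset level (two-subgroup TPP towers, second order)

Solo-blind seat (MatrixMultiplication), companion note `LieExponent.md`, §3.30 (Proposition 16 and
Remark 16.1: the analysis of the RESET levels of Theorem 15, i.e. of question (Q_L10)).

Setting of §3.29/§3.30: `(M₁; H₂, H₃)` a TPP triple in a real Lie group, `H₂, H₃` connected Lie
subgroups with `𝔥₂ ∩ 𝔥₃ = 0`, `U₀ = 𝔥₂ ⊕ 𝔥₃`; at level `ℓ` of the tower the characteristic algebra is a
Lie subalgebra `𝔞 = 𝔞_ℓ`, the inherited reference space is `W = 𝔞 ∩ U₀`, the level pair is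
`U_𝔞 = (𝔥₂ ∩ 𝔞) ⊕ (𝔥₃ ∩ 𝔞) ⊆ W`, and the PHANTOM SPACE is `J = W / U_𝔞` (dimension `j`, the quantity
that a reset may cash, Theorem 15(v)).  For every covector `λ` killing `𝔞 + U₀` (the space `Π` of
§3.30) the **phantom form** is `β_λ(w, w') := λ [π₂ w, π₃ w']` on `W`, where `w = π₂ w + π₃ w` is the
splitting along `𝔥₂ ⊕ 𝔥₃`.

Proved here over an arbitrary commutative ring, for Lie subalgebras `A, H₂, H₃` of any Lie algebra and
any linear form `φ` vanishing on `A`, `H₂` and `H₃` (no direct-sum hypothesis is needed: the statements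
are about chosen splittings `w = y₂ + y₃`):

* `soloLie_phantom_symmetric` — `β_φ` is SYMMETRIC: if `y₂ + y₃ ∈ A` and `y₂' + y₃' ∈ A` then
  `φ [y₂, y₃'] = φ [y₂', y₃]` (Proposition 16(a));
* `soloLie_phantom_radical_right`, `soloLie_phantom_radical_left` — the level pair lies in the
  RADICAL of `β_φ`: if moreover `y₃' ∈ A` (resp. `y₂' ∈ A`) the value is `0` (Proposition 16(a)), so
  `β_φ` descends to the phantom space `J`;
* `soloLie_phantom_diag_pair` — on the level pair itself the quadratic form vanishes
  (`y₂, y₃ ∈ A ⇒ φ [y₂, y₃] = 0`), i.e. `U_𝔞` lies in the null cone that contains the tangent cone of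
  the obstacle `H₃H₂ ∩ A` (Proposition 16(b));
* `soloLie_flatReset_sigma_le`, `soloLie_flatReset_terminates` — the dimension bookkeeping of
  Proposition 16(c) (a FLAT reset terminates the tower: fibre count of the submersion
  `S × S × H₂ × H₃ → A·H₂·H₃` gives `σ ≤ c`, hence `Σ_ℓ ≤ a_ℓ − j ≤ a_ℓ`).

All geometric content (constant-rank theorem, the tower of Theorem 10/15) stays in the note; this file
certifies the algebra that the note's second-order analysis rests on.
-/

set_option linter.dupNamespace false

namespace Summit.MatrixMultiplication.MatrixMultiplication.Theorems

section PhantomForm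

variable {K L : Type*} [CommRing K] [LieRing L] [LieAlgebra K L]

/-- **Proposition 16(a), symmetry of the phantom form.**  Let `A, H₂, H₃` be Lie subalgebras and `φ`
a linear form vanishing on each of them.  If `y₂, y₂' ∈ H₂`, `y₃, y₃' ∈ H₃` and both `y₂ + y₃` and
`y₂' + y₃'` lie in `A`, then `φ [y₂, y₃'] = φ [y₂', y₃]`.  [new result (elementary); LieExponent.md
§3.30] -/
theorem soloLie_phantom_symmetric (A H₂ H₃ : LieSubalgebra K L) (φ : L →ₗ[K] K)
    (hA : ∀ x ∈ A, φ x = 0) (hH₂ : ∀ x ∈ H₂, φ x = 0) (hH₃ : ∀ x ∈ H₃, φ x = 0)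
    {y₂ y₂' y₃ y₃' : L} (hy₂ : y₂ ∈ H₂) (hy₂' : y₂' ∈ H₂) (hy₃ : y₃ ∈ H₃) (hy₃' : y₃' ∈ H₃)
    (hw : y₂ + y₃ ∈ A) (hw' : y₂' + y₃' ∈ A) :
    φ ⁅y₂, y₃'⁆ = φ ⁅y₂', y₃⁆ := by
  -- the bracket of the two elements of `A` lies in `A`, hence is killed by `φ`
  have h0 : φ ⁅y₂ + y₃, y₂' + y₃'⁆ = 0 := hA _ (A.lie_mem hw hw')
  have h22 : φ ⁅y₂, y₂'⁆ = 0 := hH₂ _ (H₂.lie_mem hy₂ hy₂')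
  have h33 : φ ⁅y₃, y₃'⁆ = 0 := hH₃ _ (H₃.lie_mem hy₃ hy₃')
  have hskew : ⁅y₃, y₂'⁆ = -⁅y₂', y₃⁆ := (lie_skew y₃ y₂').symm
  have hexp : φ ⁅y₂ + y₃, y₂' + y₃'⁆ =
      φ ⁅y₂, y₂'⁆ + φ ⁅y₂, y₃'⁆ + (φ ⁅y₃, y₂'⁆ + φ ⁅y₃, y₃'⁆) := by
    simp only [add_lie, lie_add, map_add]
    abel
  have hneg : φ ⁅y₃, y₂'⁆ = -φ ⁅y₂', y₃⁆ := by rw [hskew, map_neg]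
  rw [hexp, h22, h33, hneg] at h0
  -- h0 : 0 + φ [y₂, y₃'] + (-φ [y₂', y₃] + 0) = 0
  have : φ ⁅y₂, y₃'⁆ - φ ⁅y₂', y₃⁆ = 0 := by
    simpa [sub_eq_add_neg, add_assoc] using h0
  exact sub_eq_zero.mp this

/-- **Proposition 16(a), radical (right slot).**  With `A, H₂, H₃, φ` as above: if `y₂ ∈ H₂`, `y₃ ∈ H₃`,
`y₂ + y₃ ∈ A` and `u ∈ H₃ ∩ A`, then `φ [y₂, u] = 0` — the level pair `(H₂ ∩ A) ⊕ (H₃ ∩ A)` lies in the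
radical of the phantom form, which therefore lives on the phantom space `J = W/U_𝔞`.
[new result (elementary); LieExponent.md §3.30] -/
theorem soloLie_phantom_radical_right (A H₃ : LieSubalgebra K L) (φ : L →ₗ[K] K)
    (hA : ∀ x ∈ A, φ x = 0) (hH₃ : ∀ x ∈ H₃, φ x = 0)
    {y₂ y₃ u : L} (hy₃ : y₃ ∈ H₃) (hw : y₂ + y₃ ∈ A) (hu₃ : u ∈ H₃) (huA : u ∈ A) :
    φ ⁅y₂, u⁆ = 0 := by
  have h1 : φ ⁅y₂ + y₃, u⁆ = 0 := hA _ (A.lie_mem hw huA)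
  have h2 : φ ⁅y₃, u⁆ = 0 := hH₃ _ (H₃.lie_mem hy₃ hu₃)
  have hexp : φ ⁅y₂ + y₃, u⁆ = φ ⁅y₂, u⁆ + φ ⁅y₃, u⁆ := by
    simp only [add_lie, map_add]
  rw [hexp, h2, add_zero] at h1
  exact h1

/-- **Proposition 16(a), radical (left slot).**  Symmetrically: if `y₂ ∈ H₂`, `y₂ + y₃ ∈ A` and
`u ∈ H₂ ∩ A`, then `φ [u, y₃] = 0`.  [new result (elementary); LieExponent.md §3.30] -/
theorem soloLie_phantom_radical_left (A H₂ : LieSubalgebra K L) (φ : L →ₗ[K] K)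
    (hA : ∀ x ∈ A, φ x = 0) (hH₂ : ∀ x ∈ H₂, φ x = 0)
    {y₂ y₃ u : L} (hy₂ : y₂ ∈ H₂) (hw : y₂ + y₃ ∈ A) (hu₂ : u ∈ H₂) (huA : u ∈ A) :
    φ ⁅u, y₃⁆ = 0 := by
  have h1 : φ ⁅u, y₂ + y₃⁆ = 0 := hA _ (A.lie_mem huA hw)
  have h2 : φ ⁅u, y₂⁆ = 0 := hH₂ _ (H₂.lie_mem hu₂ hy₂)
  have hexp : φ ⁅u, y₂ + y₃⁆ = φ ⁅u, y₂⁆ + φ ⁅u, y₃⁆ := by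
    simp only [lie_add, map_add]
  rw [hexp, h2, zero_add] at h1
  exact h1

/-- **Proposition 16(b), the level pair is in the null cone.**  If both summands of `w = y₂ + y₃`
lie in `A` (i.e. `w ∈ U_𝔞 = (H₂ ∩ A) ⊕ (H₃ ∩ A)`), then the phantom quadratic form vanishes at `w`:
`φ [y₂, y₃] = 0`.  (The tangent cone of the obstacle `H₃H₂ ∩ A` at `1` is contained in the null cone
`{β_λ(w,w) = 0 ∀ λ ∈ Π}`, which therefore contains `U_𝔞`, as it must since `K₃K₂ ⊆ H₃H₂ ∩ A`.)
[new result (elementary); LieExponent.md §3.30] -/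
theorem soloLie_phantom_diag_pair (A : LieSubalgebra K L) (φ : L →ₗ[K] K)
    (hA : ∀ x ∈ A, φ x = 0) {y₂ y₃ : L} (hy₂ : y₂ ∈ A) (hy₃ : y₃ ∈ A) :
    φ ⁅y₂, y₃⁆ = 0 :=
  hA _ (A.lie_mem hy₂ hy₃)

end PhantomForm

section FlatReset

/-- **Proposition 16(c), fibre count at a flat reset.**  At a reset level the map
`Ψ(s, s', h₂, h₃) = s s'⁻¹ h₂ h₃` from the `(2σ + (d − m))`-dimensional source is a submersion onto the
`ν`-dimensional manifold `A·H₂·H₃` (flatness), `ν = d − m + c` with `c = codim_𝔞 (𝔞 ∩ U₀)`; its fibre over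
`1` is a manifold of dimension `2σ + (d − m) − ν` containing the `σ`-dimensional diagonal, and TPP forces
equality of germs, i.e. `2σ + (d − m) − ν ≤ σ`.  Conclusion: `σ ≤ c`.  [bookkeeping; LieExponent.md
§3.30] -/
theorem soloLie_flatReset_sigma_le (σ d m c ν : ℕ) (hν : ν = d - m + c)
    (hfib : 2 * σ + (d - m) - ν ≤ σ) : σ ≤ c := by
  subst hν
  omega

/-- **Proposition 16(c), a flat reset terminates the tower.**  With `a = dim 𝔞`, `w = dim (𝔞 ∩ U₀) = a − c`,
level pair of dimension `k = k₂ + k₃ = w − j` (`j` = phantom dimension) and curved slice of dimension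
`σ ≤ c`: the level total `Σ_ℓ = σ + k` is at most `a − j ≤ a`, so `ℓ` is the terminal level `t` of
Theorem 10 (no phantom is cashed).  [bookkeeping; LieExponent.md §3.30] -/
theorem soloLie_flatReset_terminates (σ a c w j k : ℕ) (hw : w + c = a) (hk : k + j = w)
    (hσ : σ ≤ c) : σ + k + j ≤ a ∧ σ + k ≤ a := by
  constructor <;> omega

/-- **Remark 16.1 (why Theorem 15 is not improved by jets of order ≤ 2).**  In the worst case allowed by
the first- and second-order constraints — a reset at every level `ℓ = 1, …, m − 1`, each cashing the
maximal phantom, so that the restart budgets are `m − 2, m − 3, …, 0` on top of the initial `m − 1` —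
Theorem 15(v)'s total-motion bound `(m − 1) + Σ_{ℓ=1}^{m−1} (m − 1 − ℓ)` equals Theorem 14(iv)'s
triangular bound `m(m − 1)/2`.  Recorded as the polynomial identity (over `ℤ`, both sides doubled)
`2(m − 1) + (m − 1)(m − 2) = m(m − 1)`.  [bookkeeping; LieExponent.md §3.30] -/
theorem soloLie_reset_worstcase (m : ℤ) : 2 * (m - 1) + (m - 1) * (m - 2) = m * (m - 1) := by
  ring

end FlatReset

end Summit.MatrixMultiplication.MatrixMultiplication.Theorems
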